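import Summits.MatrixMultiplication.MatrixMultiplication.Theorems.SubgroupIdentityDesigns.Negative.DihedralUnipotent

/-!
# Reflected translation group: a character-free affine exclusion in the member window
(cell B2b-5, gen 21)

VALUE = THEOREM on the level-one slice of `SubgroupIdentityDesigns` — NOT summit progress; the crux
(`stmt-MatrixMultiplication-14079`) is untouched.

`m = 3`, all odd `p`, every `ε`, no TPP.  Let `T(ℓ) = {v ↦ v + φ(v) e₀}` be the translation group
of the line `ℓ = 𝔽_p e₀` (order `p²`, a CARRIER on its own) and `s = diag(1,1,-1)` — a reflection
fixing `ℓ` pointwise whose `(-1)`-eigenvector lies outside `Fix(s) ⊇ ℓ`.  The group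
`K = T(ℓ) ⋊ ⟨s⟩ = {R(a,b,±1)}`, `R(a,b,e) = [[1,a,b],[0,1,0],[0,0,e]]`, has order `2p²`, which lies
IN THE MEMBER WINDOW `[p²+p+1, p³-3]`.  The GAP catalogue (ORACLE-g21 §G21-10b, kit j144577) finds
it at `(3,5)` as a minimal non-carrier of order `50` that is NOT a determinant cover (its failing
linear characters have order `2p = 10`: `σ(R(a,b,(-1)^j)) = (-1)^j ψ(a)`), together with its dual.

THE FUNCTIONAL (character-free form of "`σ` has no admissible vector"):
`L h = Σ_{a,b ∈ 𝔽_p} Σ_{j<2} (-1)^j ψ(a) h(R(a,b,(-1)^j))` (`ψ` the standard additive character)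
kills every vector transport `g ↦ [g u = w]`:  if `u₂ ≠ 0` then for fixed `a, j` exactly one `b`
(or none, independently of `a`) satisfies `R u = w`, and `Σ_a ψ(a) = 0`; if `u₂ = 0` the condition
does not see `b, j` and `Σ_j (-1)^j = 0`.  Hence `L` kills `F₁`; on an identity test covering
`K ∖ 1` it equals `1`.  Consequences: `K` lies in NO MEMBER (`no_design_same₁`), and `T(ℓ)` in one
member with `s` in another is excluded as well (`no_design_Ts₁₂`, `no_design_sT₁₂`, `no_design_Ts₁₃`).
Exactness of the hypotheses (sanity DATA, code/g21/treflect_check.py, `p = 3,5,7`): with `s`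
replaced by any other diagonal involution (`diag(-1,1,1)`, `diag(1,-1,-1)`, `-s`, …) the group
`T(ℓ) ⋊ ⟨s'⟩` IS a carrier.  Other frames: `DesignConjGL`; the dual family: `DualityTransport`.
-/

open scoped BigOperators Classical Matrix

set_option linter.dupNamespace false

noncomputable section

namespace Summit.MatrixMultiplication.MatrixMultiplication.Theorems.SubgroupIdentityDesigns.Negative
namespace ReflectedTranslation

open Summit.MatrixMultiplication.MatrixMultiplication.Theorems.LieRankDesigns.Negative (GLm Mat)
open Summit.MatrixMultiplication.MatrixMultiplication.Theorems.LevelOneGL2Designs.Negative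
  (levelSubmodule)
open PackingBridge (exists_test)
open VectorTransportSpan (levelSubmodule_le_of_transport)
open DihedralUnipotent (neg_one_ne_one)

variable {p : ℕ} [hp : Fact p.Prime]

/-! ## The elements `R(a,b,e)` -/

/-- `R(a,b,e) = [[1,a,b],[0,1,0],[0,0,e]]`. -/
def Rmat (a b e : ZMod p) : Mat p 3 := !![1, a, b; 0, 1, 0; 0, 0, e]

/-- Multiplication law. -/
theorem Rmat_mul (a b e a' b' e' : ZMod p) :
    Rmat a b e * Rmat a' b' e' = Rmat (a + a') (b' + b * e') (e * e') := by
  ext i j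
  fin_cases i <;> fin_cases j <;> simp [Rmat, Matrix.mul_apply, Fin.sum_univ_three]
  ring

/-- `R(0,0,1) = 1`. -/
theorem Rmat_one : Rmat (0 : ZMod p) 0 1 = 1 := by
  ext i j
  fin_cases i <;> fin_cases j <;> simp [Rmat]

/-- The sign `(-1)^j`. -/
def sg (j : ℕ) : ZMod p := (-1) ^ j

/-- `sg j * sg j = 1`. -/
theorem sg_mul_sg (j : ℕ) : sg (p := p) j * sg j = 1 := by
  rw [sg, ← mul_pow, neg_one_mul, neg_neg, one_pow]

/-- `R(a,b,(-1)^j)` as an element of `GL₃(𝔽_p)`. -/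
def RGL (a b : ZMod p) (j : ℕ) : GLm p 3 where
  val := Rmat a b (sg j)
  inv := Rmat (-a) (-(b * sg j)) (sg j)
  val_inv := by
    rw [Rmat_mul, sg_mul_sg, add_neg_cancel, neg_add_cancel, Rmat_one]
  inv_val := by
    rw [Rmat_mul, sg_mul_sg, neg_add_cancel, neg_mul, mul_assoc, sg_mul_sg, mul_one,
      add_neg_cancel, Rmat_one]

/-- Underlying matrix of `RGL`. -/
@[simp] theorem coe_RGL (a b : ZMod p) (j : ℕ) : ((RGL a b j : GLm p 3) : Mat p 3) = Rmat a b (sg j) :=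
  rfl

/-- `R(a,b,(-1)^j) u` in coordinates. -/
theorem RGL_mulVec (a b : ZMod p) (j : ℕ) (u : Fin 3 → ZMod p) :
    ((RGL a b j : GLm p 3) : Mat p 3) *ᵥ u = ![u 0 + a * u 1 + b * u 2, u 1, sg j * u 2] := by
  ext i
  fin_cases i <;> simp [Rmat, Matrix.mulVec, dotProduct, Fin.sum_univ_three]

/-- `R(a,b,(-1)^j) = 1` (`j < 2`, `p` odd) only for `(a,b,j) = (0,0,0)`. -/
theorem RGL_eq_one (hp2 : p ≠ 2) {a b : ZMod p} {j : ℕ} (hj : j < 2)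
    (h : (RGL a b j : GLm p 3) = 1) : a = 0 ∧ b = 0 ∧ j = 0 := by
  have hM := congrArg (fun g : GLm p 3 => (g : Mat p 3)) h
  simp only [coe_RGL, Units.val_one] at hM
  have h01 := congrFun (congrFun hM 0) 1
  have h02 := congrFun (congrFun hM 0) 2
  have h22 := congrFun (congrFun hM 2) 2
  simp [Rmat] at h01 h02 h22
  refine ⟨h01, h02, ?_⟩
  by_contra hj0
  have hj1 : j = 1 := by omega
  subst hj1
  rw [sg, pow_one] at h22
  exact neg_one_ne_one hp2 h22

/-! ## The functional -/

/-- `L h = Σ_{a,b} Σ_{j<2} (-1)^j ψ(a) h(R(a,b,(-1)^j))`. -/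
def L : (GLm p 3 → ℂ) →ₗ[ℂ] ℂ where
  toFun h := ∑ a : ZMod p, ∑ b : ZMod p, ∑ j : Fin 2,
    (-1 : ℂ) ^ (j : ℕ) * (ZMod.stdAddChar (N := p) a : ℂ) * h (RGL a b (j : ℕ))
  map_add' f g := by
    simp only [Pi.add_apply, mul_add, Finset.sum_add_distrib]
  map_smul' c f := by
    simp only [Pi.smul_apply, smul_eq_mul, RingHom.id_apply, Finset.mul_sum, mul_left_comm]

/-- Unfolding `L`. -/
theorem L_apply (h : GLm p 3 → ℂ) : L h = ∑ a : ZMod p, ∑ b : ZMod p, ∑ j : Fin 2,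
    (-1 : ℂ) ^ (j : ℕ) * (ZMod.stdAddChar (N := p) a : ℂ) * h (RGL a b (j : ℕ)) := rfl

/-- `Σ_{j<2} (-1)^j = 0`. -/
theorem sum_sign : ∑ j : Fin 2, (-1 : ℂ) ^ (j : ℕ) = 0 := by
  simp [Fin.sum_univ_two]

/-- `Σ_a ψ(a) = 0`. -/
theorem sum_psi : ∑ a : ZMod p, (ZMod.stdAddChar (N := p) a : ℂ) = 0 := by
  have h : (ZMod.stdAddChar (N := p)) ≠ 1 := by
    have h1 := ZMod.isPrimitive_stdAddChar p (one_ne_zero (α := ZMod p))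
    rwa [AddChar.mulShift_one] at h1
  exact AddChar.sum_eq_zero_of_ne_one h

omit hp in
/-- A vector of `𝔽_p^3` as a literal. -/
theorem vec3_eta (w : Fin 3 → ZMod p) : w = ![w 0, w 1, w 2] := by
  ext i; fin_cases i <;> rfl

/-- The transport condition `R(a,b,(-1)^j) u = w` in coordinates. -/
theorem cond_iff (a b : ZMod p) (j : ℕ) (u w : Fin 3 → ZMod p) :
    ((RGL a b j : GLm p 3) : Mat p 3) *ᵥ u = w ↔
      u 0 + a * u 1 + b * u 2 = w 0 ∧ u 1 = w 1 ∧ sg j * u 2 = w 2 := by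
  rw [RGL_mulVec]
  conv_lhs => rw [vec3_eta w]
  simp only [Matrix.vecCons_inj, and_true]

/-- `u₂ ≠ 0`: for fixed `a, j` the `b`-count of solutions does not depend on `a`. -/
theorem sum_b (a : ZMod p) (j : ℕ) {u : Fin 3 → ZMod p} (hu : u 2 ≠ 0) (w : Fin 3 → ZMod p) :
    (∑ b : ZMod p, if ((RGL a b j : GLm p 3) : Mat p 3) *ᵥ u = w then (1 : ℂ) else 0) =
      if u 1 = w 1 ∧ sg j * u 2 = w 2 then 1 else 0 := by
  have key : ∀ b : ZMod p, (((RGL a b j : GLm p 3) : Mat p 3) *ᵥ u = w ↔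
      b = (w 0 - u 0 - a * u 1) * (u 2)⁻¹ ∧ (u 1 = w 1 ∧ sg j * u 2 = w 2)) := by
    intro b
    rw [cond_iff]
    constructor
    · rintro ⟨h0, h1, h2⟩
      refine ⟨?_, h1, h2⟩
      rw [eq_mul_inv_iff_mul_eq₀ hu]
      linear_combination h0
    · rintro ⟨hb, h1, h2⟩
      refine ⟨?_, h1, h2⟩
      rw [eq_mul_inv_iff_mul_eq₀ hu] at hb
      linear_combination hb
  simp_rw [key]
  by_cases hQ : u 1 = w 1 ∧ sg j * u 2 = w 2
  · simp [hQ, Finset.sum_ite_eq']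
  · simp [hQ]

/-- **`L` kills every vector transport.** -/
theorem L_transport (u w : Fin 3 → ZMod p) :
    L (fun g : GLm p 3 => if (g : Mat p 3) *ᵥ u = w then (1 : ℂ) else 0) = 0 := by
  rw [L_apply]
  by_cases hu : u 2 = 0
  · -- the condition does not see `b` and `j`
    refine Finset.sum_eq_zero fun a _ => Finset.sum_eq_zero fun b _ => ?_
    have key : ∀ j : Fin 2, (((RGL a b (j : ℕ) : GLm p 3) : Mat p 3) *ᵥ u = w ↔
        u 0 + a * u 1 = w 0 ∧ u 1 = w 1 ∧ (0 : ZMod p) = w 2) := by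
      intro j
      rw [cond_iff, hu, mul_zero, add_zero, mul_zero]
    simp_rw [key]
    rw [← Finset.sum_mul, ← Finset.sum_mul, sum_sign, zero_mul, zero_mul]
  · -- `u₂ ≠ 0`: sum over `b` first, then the character sum over `a`
    have inner : ∀ a : ZMod p, (∑ b : ZMod p, ∑ j : Fin 2, (-1 : ℂ) ^ (j : ℕ) *
        (ZMod.stdAddChar (N := p) a : ℂ) *
        (if (((RGL a b (j : ℕ) : GLm p 3) : Mat p 3) *ᵥ u = w) then (1 : ℂ) else 0)) =
        ∑ j : Fin 2, (-1 : ℂ) ^ (j : ℕ) * (ZMod.stdAddChar (N := p) a : ℂ) *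
          (if u 1 = w 1 ∧ sg (p := p) j * u 2 = w 2 then (1 : ℂ) else 0) := by
      intro a
      rw [Finset.sum_comm]
      refine Finset.sum_congr rfl fun j _ => ?_
      rw [← Finset.mul_sum, sum_b a j hu w]
    simp_rw [inner]
    rw [Finset.sum_comm]
    refine Finset.sum_eq_zero fun j _ => ?_
    have : ∀ a : ZMod p, (-1 : ℂ) ^ (j : ℕ) * (ZMod.stdAddChar (N := p) a : ℂ) *
        (if u 1 = w 1 ∧ sg (p := p) j * u 2 = w 2 then (1 : ℂ) else 0) =
        (ZMod.stdAddChar (N := p) a : ℂ) * ((-1 : ℂ) ^ (j : ℕ) *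
        (if u 1 = w 1 ∧ sg (p := p) j * u 2 = w 2 then (1 : ℂ) else 0)) := by
      intro a; ring
    simp_rw [this]
    rw [← Finset.sum_mul, sum_psi, zero_mul]

/-- **`L` of an identity test covering `K ∖ 1` is `1`.** -/
theorem L_delta (hp2 : p ≠ 2) {h : GLm p 3 → ℂ} (h1 : h 1 = 1)
    (h0 : ∀ a b : ZMod p, ∀ j < 2, (RGL a b j : GLm p 3) ≠ 1 → h (RGL a b j) = 0) :
    L h = 1 := by
  rw [L_apply]
  have hval : ∀ (a b : ZMod p) (j : Fin 2), ¬ (a = 0 ∧ b = 0 ∧ (j : ℕ) = 0) →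
      (-1 : ℂ) ^ (j : ℕ) * (ZMod.stdAddChar (N := p) a : ℂ) * h (RGL a b (j : ℕ)) = 0 := by
    intro a b j hne
    have hne' : (RGL a b (j : ℕ) : GLm p 3) ≠ 1 := fun heq => hne (RGL_eq_one hp2 j.isLt heq)
    rw [h0 a b j j.isLt hne', mul_zero]
  rw [Finset.sum_eq_single (0 : ZMod p), Finset.sum_eq_single (0 : ZMod p),
    Finset.sum_eq_single (⟨0, by omega⟩ : Fin 2)]
  · have hR : (RGL (0 : ZMod p) 0 ((⟨0, by omega⟩ : Fin 2) : ℕ) : GLm p 3) = 1 :=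
      Units.ext (by simp [sg, Rmat_one])
    rw [hR, h1]
    simp
  · intro j _ hj
    exact hval 0 0 j fun ⟨_, _, h⟩ => hj (Fin.ext h)
  · intro h; exact absurd (Finset.mem_univ _) h
  · intro b _ hb
    exact Finset.sum_eq_zero fun j _ => hval 0 b j fun ⟨_, h, _⟩ => hb h
  · intro h; exact absurd (Finset.mem_univ _) h
  · intro a _ ha
    exact Finset.sum_eq_zero fun b _ => Finset.sum_eq_zero fun j _ =>
      hval a b j fun ⟨h, _, _⟩ => ha h
  · intro h; exact absurd (Finset.mem_univ _) h

/-! ## The exclusions -/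

variable {H₁ H₂ H₃ : Subgroup (GLm p 3)}

/-- **COVER FORM.**  If every `R(a,b,(-1)^j) ≠ 1` is a triple product `a' b' c'`
(`a' ∈ H₁, b' ∈ H₂, c' ∈ H₃`), there is no level-one identity design (`p` odd, `m = 3`, every `ε`,
no TPP). -/
theorem no_design_of_cover (hp2 : p ≠ 2)
    (hcov : ∀ a b : ZMod p, ∀ j < 2, (RGL a b j : GLm p 3) ≠ 1 →
      ∃ a' ∈ H₁, ∃ b' ∈ H₂, ∃ c' ∈ H₃, a' * b' * c' = RGL a b j) :
    ¬ ∃ c : Mat p 3 → ℂ, (∀ M, 1 < M.rank → c M = 0) ∧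
      (∑ M, c M * ZMod.stdAddChar (Matrix.trace (M * ((1 : GLm p 3) : Mat p 3)))) = 1 ∧
      ∀ a ∈ H₁, ∀ b ∈ H₂, ∀ g ∈ H₃, a * b * g ≠ 1 →
        (∑ M, c M * ZMod.stdAddChar (Matrix.trace (M * ((a * b * g : GLm p 3) : Mat p 3)))) = 0 := by
  intro hdes
  obtain ⟨f, hf, h1, h0⟩ := exists_test hdes
  have hker : levelSubmodule p 3 1 ≤ LinearMap.ker (L (p := p)) :=
    levelSubmodule_le_of_transport fun u w => by
      rw [LinearMap.mem_ker]
      exact L_transport u w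
  have hz : L f = 0 := LinearMap.mem_ker.mp (hker hf)
  have h0' : ∀ a b : ZMod p, ∀ j < 2, (RGL a b j : GLm p 3) ≠ 1 → f (RGL a b j) = 0 := by
    intro a b j hj hne
    obtain ⟨a', ha, b', hb, c', hc, habc⟩ := hcov a b j hj hne
    rw [← habc]
    exact h0 a' ha b' hb c' hc (habc ▸ hne)
  have hone := L_delta hp2 h1 h0'
  rw [hz] at hone
  exact zero_ne_one hone

/-- **THE REFLECTED TRANSLATION GROUP LIES IN NO MEMBER** (`|K| = 2p²` is in the member window):
`{R(a,b,±1)} ⊆ H₁` ⇒ no level-one identity design. -/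
theorem no_design_same₁ (hp2 : p ≠ 2) (hK : ∀ a b : ZMod p, ∀ j < 2, (RGL a b j : GLm p 3) ∈ H₁) :
    ¬ ∃ c : Mat p 3 → ℂ, (∀ M, 1 < M.rank → c M = 0) ∧
      (∑ M, c M * ZMod.stdAddChar (Matrix.trace (M * ((1 : GLm p 3) : Mat p 3)))) = 1 ∧
      ∀ a ∈ H₁, ∀ b ∈ H₂, ∀ g ∈ H₃, a * b * g ≠ 1 →
        (∑ M, c M * ZMod.stdAddChar (Matrix.trace (M * ((a * b * g : GLm p 3) : Mat p 3)))) = 0 :=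
  no_design_of_cover hp2 fun a b j hj _ =>
    ⟨RGL a b j, hK a b j hj, 1, H₂.one_mem, 1, H₃.one_mem, by rw [mul_one, mul_one]⟩

/-- `R(a,b,(-1)^j) = R(a, (-1)^j b, 1) · s` with `s = R(0,0,(-1)^j)`. -/
theorem RGL_eq_T_mul_s (a b : ZMod p) (j : ℕ) :
    (RGL a b j : GLm p 3) = RGL a (b * sg j) 0 * RGL 0 0 j := by
  apply Units.ext
  simp only [Units.val_mul, coe_RGL, Rmat_mul]
  simp [sg, mul_assoc, ← mul_pow]

/-- `R(a,b,(-1)^j) = s · R(a,b,1)` with `s = R(0,0,(-1)^j)`. -/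
theorem RGL_eq_s_mul_T (a b : ZMod p) (j : ℕ) :
    (RGL a b j : GLm p 3) = RGL 0 0 j * RGL a b 0 := by
  apply Units.ext
  simp only [Units.val_mul, coe_RGL, Rmat_mul]
  simp [sg]

/-- **`T(ℓ) ≤ H₁` and the reflection `s ∈ H₂`** ⇒ no level-one identity design. -/
theorem no_design_Ts₁₂ (hp2 : p ≠ 2) (hT : ∀ a b : ZMod p, (RGL a b 0 : GLm p 3) ∈ H₁)
    (hs : (RGL 0 0 1 : GLm p 3) ∈ H₂) :
    ¬ ∃ c : Mat p 3 → ℂ, (∀ M, 1 < M.rank → c M = 0) ∧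
      (∑ M, c M * ZMod.stdAddChar (Matrix.trace (M * ((1 : GLm p 3) : Mat p 3)))) = 1 ∧
      ∀ a ∈ H₁, ∀ b ∈ H₂, ∀ g ∈ H₃, a * b * g ≠ 1 →
        (∑ M, c M * ZMod.stdAddChar (Matrix.trace (M * ((a * b * g : GLm p 3) : Mat p 3)))) = 0 := by
  refine no_design_of_cover hp2 fun a b j hj _ => ?_
  refine ⟨RGL a (b * sg j) 0, hT _ _, RGL 0 0 j, ?_, 1, H₃.one_mem, ?_⟩
  · interval_cases j
    · have : (RGL (0 : ZMod p) 0 0 : GLm p 3) = 1 := Units.ext (by simp [sg, Rmat_one])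
      rw [this]; exact H₂.one_mem
    · exact hs
  · rw [mul_one, ← RGL_eq_T_mul_s]

/-- **`s ∈ H₁` and `T(ℓ) ≤ H₂`** ⇒ no level-one identity design. -/
theorem no_design_sT₁₂ (hp2 : p ≠ 2) (hs : (RGL 0 0 1 : GLm p 3) ∈ H₁)
    (hT : ∀ a b : ZMod p, (RGL a b 0 : GLm p 3) ∈ H₂) :
    ¬ ∃ c : Mat p 3 → ℂ, (∀ M, 1 < M.rank → c M = 0) ∧
      (∑ M, c M * ZMod.stdAddChar (Matrix.trace (M * ((1 : GLm p 3) : Mat p 3)))) = 1 ∧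
      ∀ a ∈ H₁, ∀ b ∈ H₂, ∀ g ∈ H₃, a * b * g ≠ 1 →
        (∑ M, c M * ZMod.stdAddChar (Matrix.trace (M * ((a * b * g : GLm p 3) : Mat p 3)))) = 0 := by
  refine no_design_of_cover hp2 fun a b j hj _ => ?_
  refine ⟨RGL 0 0 j, ?_, RGL a b 0, hT _ _, 1, H₃.one_mem, ?_⟩
  · interval_cases j
    · have : (RGL (0 : ZMod p) 0 0 : GLm p 3) = 1 := Units.ext (by simp [sg, Rmat_one])
      rw [this]; exact H₁.one_mem
    · exact hs
  · rw [mul_one, ← RGL_eq_s_mul_T]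

/-- **`T(ℓ) ≤ H₁` and `s ∈ H₃`** ⇒ no level-one identity design. -/
theorem no_design_Ts₁₃ (hp2 : p ≠ 2) (hT : ∀ a b : ZMod p, (RGL a b 0 : GLm p 3) ∈ H₁)
    (hs : (RGL 0 0 1 : GLm p 3) ∈ H₃) :
    ¬ ∃ c : Mat p 3 → ℂ, (∀ M, 1 < M.rank → c M = 0) ∧
      (∑ M, c M * ZMod.stdAddChar (Matrix.trace (M * ((1 : GLm p 3) : Mat p 3)))) = 1 ∧
      ∀ a ∈ H₁, ∀ b ∈ H₂, ∀ g ∈ H₃, a * b * g ≠ 1 →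
        (∑ M, c M * ZMod.stdAddChar (Matrix.trace (M * ((a * b * g : GLm p 3) : Mat p 3)))) = 0 := by
  refine no_design_of_cover hp2 fun a b j hj _ => ?_
  refine ⟨RGL a (b * sg j) 0, hT _ _, 1, H₂.one_mem, RGL 0 0 j, ?_, ?_⟩
  · interval_cases j
    · have : (RGL (0 : ZMod p) 0 0 : GLm p 3) = 1 := Units.ext (by simp [sg, Rmat_one])
      rw [this]; exact H₃.one_mem
    · exact hs
  · rw [mul_one, ← RGL_eq_T_mul_s]

end ReflectedTranslation
end Summit.MatrixMultiplication.MatrixMultiplication.Theorems.SubgroupIdentityDesigns.Negative
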